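import Summits.Schanuel.Schanuel.Theses.RootDecomp1E
import Summits.Schanuel.Schanuel.Theorems.RootDecomp1EAnchorToolkit
import Summits.Schanuel.Schanuel.Theorems.RootDecomp1EEngineType
import Literature.NumberTheory.Transcendental.LindemannWeierstrassProofs

/-!
# RootDecomp1E · round 14 (lens-2 «structural dichotomy», gen 14) — HYPERPLANE SCHANUEL

Node file of the decomp-schanuel cell (HOME/decomp-schanuel-lens-2/g14/Hyperplane.lean); port target
`Summits/Schanuel/Schanuel/Theorems/RootDecomp1EHyperplane.lean --supports stmt-Schanuel-25020`.

## What is proved (0 sorry; axioms std)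

§1 **EXCHANGE LEMMA** `trdeg_exchange` (pure transcendence-degree theory, no exponentials):
   `m ≤ trdeg ℚ(S)`, `m + 1 ≤ trdeg ℚ(S ∪ A ∪ B)` ⟹ `m + 1 ≤ trdeg ℚ(S ∪ A)` or `m + 1 ≤ trdeg ℚ(S ∪ B)`.
   (If both fail, `A` and `B` are algebraic over `ℚ(S)` by the sandwich lemma, so `ℚ(S ∪ A ∪ B)` is too.)

§2 **FACE EXCHANGE** `face_exchange` for the Schanuel fields `F_z = ℚ(z, e^z)`: if a codimension-2 face `u` of
   `z ∈ ℂ^{n+2}` has `trdeg F_u ≥ m` and `trdeg F_z ≥ m + 1`, one of the two hyperplane faces through `u` has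
   `trdeg ≥ m + 1`.

§3 **THEOREM (HYPERPLANE SCHANUEL).** `DefectOneSchanuel ↔ HyperplaneSchanuel` (`defectOne_iff_hyperplaneSchanuel`):
   one-defect Schanuel `S⁻` (stmt-Schanuel-25020: `n ≤ trdeg F_z + 1` for ℚ-free `z`) is EQUIVALENT to
   `𝓗 : every ℚ-free (n+1)-tuple has a coordinate HYPERPLANE FACE satisfying FULL Schanuel`
   (`∃ p, n ≤ trdeg F_{z ∘ p.succAbove}`).  `⟸` is monotonicity; `⟹` is an induction on the length whose
   step is the face exchange (the Schanuel face of `z` is found among the two hyperplanes through a Schanuel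
   codimension-2 face supplied by the induction hypothesis).  So the defect-one cell of the root decomposition
   is a COVERING STATEMENT by full-Schanuel cells one dimension down — a reading of 25020 by coordinate
   hyperplanes, orthogonal to the saturation (round 13, THEOREM A) and type (rounds 9–12) readings.

§4a **THEOREM (TWO-FACE HYPERPLANE SCHANUEL).** `DefectOneSchanuel ↔ TwoFaceSchanuel` (`defectOne_iff_twoFace`):
   `S⁻` says EXACTLY that every coordinate of every ℚ-free tuple of length ≥ 2 lies on a Schanuel coordinate
   hyperplane face (⟺ at least TWO hyperplane faces are Schanuel; `𝓗₂ ⟹ 𝓗`).  Induction on the length with a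
   POINTED exchange step (delete an index `k ≠ p₀`, take inside that face a Schanuel codimension-2 face avoiding
   the deletion of `p₀`, exchange).

§4b **THE FIRST OPEN LENGTH n = 3, UNCONDITIONALLY** (`two_faces_of_two_le_trdeg`, `defectOneAt_three_iff`,
   `triple_demand_faces_through`, `triple_demand_iff`, `lw_pair_through`): for a triple `z` with non-zero
   coordinates, `3 ≤ trdeg F_z + 1 ⟺ some PAIR FACE of z is a Schanuel pair (trdeg ≥ 2)`, and then at least
   TWO of the three pair faces are Schanuel pairs — the two through any prescribed non-zero coordinate
   (Hermite–Lindemann floor + exchange).  Consequently every `n = 3` member demand of the plain class 31410 —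
   in particular the ELogPlane members `(1, ℓ₁, ℓ₂)` — is LITERALLY the disjunction of the three Schanuel
   PAIR CELLS of its faces (`triple_demand_iff`): the member axis at the first open length carries no statement
   that is not a disjunction of `S₂`-instances (E-R14 (b‴) «impossibility remark», made a theorem), and under
   `S⁻` every ℚ-free triple has two Schanuel pair faces (`two_schanuel_faces_of_defectOne`).  Unconditional
   instance (`lw_pair_through`, Lindemann–Weierstrass fed in): for ℚ-free algebraic `α, β` and any `t ≠ 0`,
   `(β, t)` or `(α, t)` is a Schanuel pair — e.g. `π` is algebraically independent from `e` or from `e^{√2}`.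

§4c **THE EXCEPTIONAL LINE** (`lw_exceptional_line`, unconditional): for every `t ≠ 0` the algebraic `α` whose pair
   `(α, t)` is NOT a Schanuel pair lie on ONE ℚ-line `ℚ∙γ`; off it, `2 ≤ trdeg ℚ(t, e^t, e^α)`.  For `t = iπ`:
   `π ⊥ e^α` for all algebraic `α` outside one ℚ-line (the open cell `S₂(1, iπ)` = «is `1` on that line?»).

§4d **A PLAIN MEMBER OF H–L SHAPE, DECODED** (`piPowers_member_decoded`): `(1, π², π³)` is a member of the plain class
   31410 (ℚ-free, plain, sub-tuples free — certified by `transcendental_pi` alone: `pi_cubic_coeffs_zero`), and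
   `PlainDefectOne` at it IS the pair-cell disjunction `S₂(π²,π³) ∨ S₂(1,π³) ∨ S₂(1,π²)` — the (b‴) shape test-case.

§5 `closes` — the LIVE 7-binder `RootDecomp1E.closes` with its first binder fed by `𝓗` through §3.
-/


noncomputable section

namespace Summit.Schanuel.Schanuel.Theorems.RootDecomp1EHyperplane

open Complex IntermediateField Polynomial
open Summit.Schanuel.Schanuel.Theses.RootDecomp1E (DefectOneSchanuel PlainDefectOne ClosedFormAtomSchanuel
  AlgAnchoredDarkAtomSchanuel LineLogDarkAtomSchanuel DeepLogDarkAtomSchanuel OffAxisClosure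
  FreeDarkAtomSchanuel)
open Summit.Schanuel.Schanuel.Theorems.RootDecomp1EAnchor (isAlgebraic_of_mem_adjoin
  trdeg_adjoin_le_of_isAlgebraic isAlgebraic_of_trdeg_sandwich exists_nat_lt_of_lt_natCast
  one_le_trdeg_adjoin_singleton trdeg_le_of_mem_span)
open Summit.Schanuel.Schanuel.Theorems.RootDecomp1EEngineType (trdeg_eq_nat
  two_le_trdeg_of_algebraicIndependent_of_isAlgebraic)
open Literature.NumberTheory.Transcendental (transcendental_exp_holds algebraicIndependent_exp_holds
  transcendental_pi_holds)
open Literature.NumberTheory.Transcendental.OneMotiveToric (trdeg_mono)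

/-! ## §1 The exchange lemma -/

/-- piece:proved · **EXCHANGE LEMMA.** `m ≤ trdeg ℚ(S)` and `m + 1 ≤ trdeg ℚ(S ∪ A ∪ B)` force
`m + 1 ≤ trdeg ℚ(S ∪ A)` or `m + 1 ≤ trdeg ℚ(S ∪ B)` [folklore: the exchange property of algebraic
dependence; proved here from the cell's sandwich lemma]. -/
theorem trdeg_exchange {S A B : Set ℂ} {m : ℕ}
    (hS : (m : Cardinal) ≤ Algebra.trdeg ℚ ↥(adjoin ℚ S))
    (hM : ((m + 1 : ℕ) : Cardinal) ≤ Algebra.trdeg ℚ ↥(adjoin ℚ (S ∪ (A ∪ B)))) :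
    ((m + 1 : ℕ) : Cardinal) ≤ Algebra.trdeg ℚ ↥(adjoin ℚ (S ∪ A)) ∨
      ((m + 1 : ℕ) : Cardinal) ≤ Algebra.trdeg ℚ ↥(adjoin ℚ (S ∪ B)) := by
  by_contra h
  rw [not_or, not_le, not_le] at h
  obtain ⟨hA, hB⟩ := h
  have hA' : Algebra.trdeg ℚ ↥(adjoin ℚ (S ∪ A)) ≤ (m : Cardinal) := by
    obtain ⟨t, ht, hte⟩ := exists_nat_lt_of_lt_natCast hA
    rw [hte]
    exact_mod_cast Nat.lt_succ_iff.mp ht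
  have hB' : Algebra.trdeg ℚ ↥(adjoin ℚ (S ∪ B)) ≤ (m : Cardinal) := by
    obtain ⟨t, ht, hte⟩ := exists_nat_lt_of_lt_natCast hB
    rw [hte]
    exact_mod_cast Nat.lt_succ_iff.mp ht
  have halg : ∀ x ∈ S ∪ (A ∪ B), IsAlgebraic ↥(adjoin ℚ S) x := by
    rintro x (hx | hx | hx)
    · exact isAlgebraic_of_mem_adjoin (subset_adjoin ℚ S hx)
    · exact isAlgebraic_of_trdeg_sandwich (T := S ∪ A) (subset_adjoin ℚ _ (Or.inr hx))
        Set.subset_union_left hA' hS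
    · exact isAlgebraic_of_trdeg_sandwich (T := S ∪ B) (subset_adjoin ℚ _ (Or.inr hx))
        Set.subset_union_left hB' hS
  have h1 : Algebra.trdeg ℚ ↥(adjoin ℚ (S ∪ (A ∪ B))) ≤ Algebra.trdeg ℚ ↥(adjoin ℚ S) :=
    trdeg_adjoin_le_of_isAlgebraic halg
  have h2 : Algebra.trdeg ℚ ↥(adjoin ℚ S) ≤ Algebra.trdeg ℚ ↥(adjoin ℚ (S ∪ A)) :=
    trdeg_mono (adjoin.mono ℚ _ _ Set.subset_union_left)
  have h3 : ((m + 1 : ℕ) : Cardinal) ≤ (m : Cardinal) := hM.trans (h1.trans (h2.trans hA'))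
  have h4 : m + 1 ≤ m := by exact_mod_cast h3
  omega

/-! ## §2 Face exchange for the Schanuel fields `F_z = ℚ(z, e^z)` -/

/-- A coordinate face `z ∘ p.succAbove` of a ℚ-free tuple is ℚ-free. -/
theorem face_linearIndependent {k : ℕ} {z : Fin (k + 1) → ℂ} (hz : LinearIndependent ℚ z)
    (p : Fin (k + 1)) : LinearIndependent ℚ (z ∘ p.succAbove) :=
  hz.comp _ Fin.succAbove_right_injective

/-- `trdeg F_{face} ≤ trdeg F_z`. -/
theorem trdeg_face_le {k : ℕ} (z : Fin (k + 1) → ℂ) (p : Fin (k + 1)) :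
    Algebra.trdeg ℚ ↥(adjoin ℚ (Set.range (z ∘ p.succAbove) ∪ Set.range (cexp ∘ (z ∘ p.succAbove)))) ≤
      Algebra.trdeg ℚ ↥(adjoin ℚ (Set.range z ∪ Set.range (cexp ∘ z))) :=
  trdeg_le_of_mem_span (z := z) (w := z ∘ p.succAbove) fun j => Submodule.subset_span ⟨p.succAbove j, rfl⟩

/-- piece:proved · **FACE EXCHANGE.** `z ∈ ℂ^{n+2}`, `u = z` minus the coordinates `p` and `p.succAbove q`:
`m ≤ trdeg F_u` and `m + 1 ≤ trdeg F_z` ⟹ the hyperplane face deleting `p` or the one deleting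
`p.succAbove q` has `trdeg ≥ m + 1`. -/
theorem face_exchange {n m : ℕ} (z : Fin (n + 2) → ℂ) (p : Fin (n + 2)) (q : Fin (n + 1))
    (hu : (m : Cardinal) ≤ Algebra.trdeg ℚ ↥(adjoin ℚ
      (Set.range ((z ∘ p.succAbove) ∘ q.succAbove) ∪ Set.range (cexp ∘ ((z ∘ p.succAbove) ∘ q.succAbove)))))
    (hz : ((m + 1 : ℕ) : Cardinal) ≤ Algebra.trdeg ℚ ↥(adjoin ℚ (Set.range z ∪ Set.range (cexp ∘ z)))) :
    ((m + 1 : ℕ) : Cardinal) ≤ Algebra.trdeg ℚ ↥(adjoin ℚ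
        (Set.range (z ∘ p.succAbove) ∪ Set.range (cexp ∘ (z ∘ p.succAbove)))) ∨
      ((m + 1 : ℕ) : Cardinal) ≤ Algebra.trdeg ℚ ↥(adjoin ℚ
        (Set.range (z ∘ (p.succAbove q).succAbove) ∪
          Set.range (cexp ∘ (z ∘ (p.succAbove q).succAbove)))) := by
  -- gens z ⊆ gens u ∪ (A ∪ B), A = {z_(p∘q), e^{z_(p∘q)}} (kept by the face deleting p),
  -- B = {z_p, e^{z_p}} (kept by the face deleting p.succAbove q)
  have h1 : Set.range z ∪ Set.range (cexp ∘ z) ⊆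
      (Set.range ((z ∘ p.succAbove) ∘ q.succAbove) ∪ Set.range (cexp ∘ ((z ∘ p.succAbove) ∘ q.succAbove))) ∪
        (({z (p.succAbove q), cexp (z (p.succAbove q))} : Set ℂ) ∪ {z p, cexp (z p)}) := by
    rintro x (⟨i, rfl⟩ | ⟨i, rfl⟩)
    · rcases Fin.eq_self_or_eq_succAbove p i with rfl | ⟨j, rfl⟩
      · exact Or.inr (Or.inr (by simp))
      · rcases Fin.eq_self_or_eq_succAbove q j with rfl | ⟨k, rfl⟩
        · exact Or.inr (Or.inl (by simp))
        · exact Or.inl (Or.inl ⟨k, rfl⟩)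
    · rcases Fin.eq_self_or_eq_succAbove p i with rfl | ⟨j, rfl⟩
      · exact Or.inr (Or.inr (by simp))
      · rcases Fin.eq_self_or_eq_succAbove q j with rfl | ⟨k, rfl⟩
        · exact Or.inr (Or.inl (by simp))
        · exact Or.inl (Or.inr ⟨k, rfl⟩)
  have h2 : (Set.range ((z ∘ p.succAbove) ∘ q.succAbove) ∪
      Set.range (cexp ∘ ((z ∘ p.succAbove) ∘ q.succAbove))) ∪
        ({z (p.succAbove q), cexp (z (p.succAbove q))} : Set ℂ) ⊆
      Set.range (z ∘ p.succAbove) ∪ Set.range (cexp ∘ (z ∘ p.succAbove)) := by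
    rintro x ((⟨k, rfl⟩ | ⟨k, rfl⟩) | hx)
    · exact Or.inl ⟨q.succAbove k, rfl⟩
    · exact Or.inr ⟨q.succAbove k, rfl⟩
    · simp only [Set.mem_insert_iff, Set.mem_singleton_iff] at hx
      rcases hx with rfl | rfl
      · exact Or.inl ⟨q, rfl⟩
      · exact Or.inr ⟨q, rfl⟩
  have h3 : (Set.range ((z ∘ p.succAbove) ∘ q.succAbove) ∪
      Set.range (cexp ∘ ((z ∘ p.succAbove) ∘ q.succAbove))) ∪ ({z p, cexp (z p)} : Set ℂ) ⊆
      Set.range (z ∘ (p.succAbove q).succAbove) ∪ Set.range (cexp ∘ (z ∘ (p.succAbove q).succAbove)) := by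
    obtain ⟨i₀, hi₀⟩ := Fin.exists_succAbove_eq (Fin.ne_succAbove p q)
    have hk : ∀ k : Fin n, ∃ i, (p.succAbove q).succAbove i = p.succAbove (q.succAbove k) := fun k =>
      Fin.exists_succAbove_eq (fun h => Fin.succAbove_ne q k (Fin.succAbove_right_injective h))
    rintro x ((⟨k, rfl⟩ | ⟨k, rfl⟩) | hx)
    · obtain ⟨i, hi⟩ := hk k
      exact Or.inl ⟨i, by simp only [Function.comp_apply, hi]⟩
    · obtain ⟨i, hi⟩ := hk k
      exact Or.inr ⟨i, by simp only [Function.comp_apply, hi]⟩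
    · simp only [Set.mem_insert_iff, Set.mem_singleton_iff] at hx
      rcases hx with rfl | rfl
      · exact Or.inl ⟨i₀, by simp only [Function.comp_apply, hi₀]⟩
      · exact Or.inr ⟨i₀, by simp only [Function.comp_apply, hi₀]⟩
  have hM : ((m + 1 : ℕ) : Cardinal) ≤ Algebra.trdeg ℚ ↥(adjoin ℚ
      ((Set.range ((z ∘ p.succAbove) ∘ q.succAbove) ∪ Set.range (cexp ∘ ((z ∘ p.succAbove) ∘ q.succAbove))) ∪
        (({z (p.succAbove q), cexp (z (p.succAbove q))} : Set ℂ) ∪ {z p, cexp (z p)}))) :=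
    hz.trans (trdeg_mono (adjoin.mono ℚ _ _ h1))
  rcases trdeg_exchange hu hM with h | h
  · exact Or.inl (h.trans (trdeg_mono (adjoin.mono ℚ _ _ h2)))
  · exact Or.inr (h.trans (trdeg_mono (adjoin.mono ℚ _ _ h3)))

/-! ## §3 THEOREM: `DefectOneSchanuel ↔ HyperplaneSchanuel` -/

/-- piece:def · **HYPERPLANE SCHANUEL `𝓗`.** Every ℚ-free `(n+1)`-tuple has a coordinate hyperplane face
`z ∘ p.succAbove` (delete ONE coordinate) satisfying FULL Schanuel: `n ≤ trdeg F_{z ∘ p.succAbove}`. -/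
def HyperplaneSchanuel : Prop :=
  ∀ (n : ℕ) (z : Fin (n + 1) → ℂ), LinearIndependent ℚ z →
    ∃ p : Fin (n + 1), (n : Cardinal) ≤
      Algebra.trdeg ℚ ↥(adjoin ℚ (Set.range (z ∘ p.succAbove) ∪ Set.range (cexp ∘ (z ∘ p.succAbove))))

/-- piece:proved · `S⁻ ⟹ 𝓗`, by induction on the length: the Schanuel hyperplane of `z ∈ ℂ^{n+2}` is one of
the two hyperplanes through a Schanuel codimension-2 face (induction hypothesis inside the face deleting
`0`), by FACE EXCHANGE fed with `S⁻` at `z` (`n + 1 ≤ trdeg F_z`). -/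
theorem hyperplaneSchanuel_of_defectOne (hD : DefectOneSchanuel) : HyperplaneSchanuel := by
  intro n
  induction n with
  | zero =>
    intro z _
    exact ⟨0, by simp⟩
  | succ n ih =>
    intro z hz
    have hw : LinearIndependent ℚ (z ∘ (0 : Fin (n + 2)).succAbove) := face_linearIndependent hz 0
    obtain ⟨q, hq⟩ := ih _ hw
    obtain ⟨t, ht, -⟩ := trdeg_eq_nat z
    have hDz := hD _ z hz
    rw [ht] at hDz
    have hnt : n + 1 + 1 ≤ t + 1 := by exact_mod_cast hDz
    have hz' : ((n + 1 : ℕ) : Cardinal) ≤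
        Algebra.trdeg ℚ ↥(adjoin ℚ (Set.range z ∪ Set.range (cexp ∘ z))) := by
      rw [ht]
      exact_mod_cast (show n + 1 ≤ t by omega)
    rcases face_exchange z 0 q hq hz' with h | h
    · exact ⟨0, h⟩
    · exact ⟨_, h⟩

/-- piece:proved · `𝓗 ⟹ S⁻` (a Schanuel hyperplane face gives defect ≤ 1 by monotonicity). -/
theorem defectOne_of_hyperplaneSchanuel (hH : HyperplaneSchanuel) : DefectOneSchanuel := by
  intro n z hz
  cases n with
  | zero => simp
  | succ k =>
    obtain ⟨p, hp⟩ := hH k z hz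
    have hle := hp.trans (trdeg_face_le z p)
    calc ((k + 1 : ℕ) : Cardinal) = (k : Cardinal) + 1 := by push_cast; rfl
      _ ≤ _ := add_le_add hle le_rfl

/-- piece:proved · **THEOREM (HYPERPLANE SCHANUEL).** One-defect Schanuel (stmt-Schanuel-25020) is EQUIVALENT to:
every ℚ-free tuple has a coordinate hyperplane face satisfying full Schanuel. -/
theorem defectOne_iff_hyperplaneSchanuel : DefectOneSchanuel ↔ HyperplaneSchanuel :=
  ⟨hyperplaneSchanuel_of_defectOne, defectOne_of_hyperplaneSchanuel⟩

/-- piece:proved · … and Schanuel itself trivially gives `𝓗` (every face of a Schanuel tuple is Schanuel). -/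
theorem hyperplaneSchanuel_of_schanuel (hS : _root_.Schanuel) : HyperplaneSchanuel := fun n _ hz =>
  ⟨0, hS n _ (face_linearIndependent hz 0)⟩

/-! ## §4 Hermite–Lindemann floor -/

/-- **Hermite–Lindemann floor.** A tuple with a non-zero coordinate `u i` has `trdeg F_u ≥ 1`
(`u i` or `e^{u i}` is transcendental; tree theorem `transcendental_exp_holds`). -/
theorem one_le_trdeg_of_ne_zero {k : ℕ} (u : Fin k → ℂ) (i : Fin k) (hi : u i ≠ 0) :
    ((1 : ℕ) : Cardinal) ≤ Algebra.trdeg ℚ ↥(adjoin ℚ (Set.range u ∪ Set.range (cexp ∘ u))) := by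
  by_cases hu : IsAlgebraic ℚ (u i)
  · have ht : ¬ IsAlgebraic ℚ (cexp (u i)) := transcendental_exp_holds hu hi
    exact (one_le_trdeg_adjoin_singleton ht).trans
      (trdeg_mono (adjoin.mono ℚ _ _ (Set.singleton_subset_iff.mpr (Or.inr ⟨i, rfl⟩))))
  · exact (one_le_trdeg_adjoin_singleton hu).trans
      (trdeg_mono (adjoin.mono ℚ _ _ (Set.singleton_subset_iff.mpr (Or.inl ⟨i, rfl⟩))))

/-! ## §4a TWO-FACE HYPERPLANE SCHANUEL: `S⁻ ↔ 𝓗₂` (every coordinate lies on a Schanuel hyperplane) -/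

/-- piece:def · **TWO-FACE HYPERPLANE SCHANUEL `𝓗₂`.** Every ℚ-free tuple of length `n + 2 ≥ 2` has, away from
ANY prescribed index `p₀`, a coordinate hyperplane face satisfying full Schanuel — equivalently: at least TWO
of its hyperplane faces are Schanuel, equivalently: every coordinate lies on a Schanuel hyperplane face. -/
def TwoFaceSchanuel : Prop :=
  ∀ (n : ℕ) (z : Fin (n + 2) → ℂ), LinearIndependent ℚ z → ∀ p₀ : Fin (n + 2),
    ∃ p : Fin (n + 2), p ≠ p₀ ∧ ((n + 1 : ℕ) : Cardinal) ≤
      Algebra.trdeg ℚ ↥(adjoin ℚ (Set.range (z ∘ p.succAbove) ∪ Set.range (cexp ∘ (z ∘ p.succAbove))))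

/-- piece:proved · `S⁻ ⟹ 𝓗₂`: induction on the length.  Base (pairs): the face `{z_{p₀}}` opposite to the other
index is Schanuel by Hermite–Lindemann.  Step: delete an index `k ≠ p₀`; inside that face the induction
hypothesis gives a Schanuel codimension-2 face `u ∌ k` AVOIDING the deletion of `p₀`; FACE EXCHANGE through
`u` then yields a Schanuel hyperplane deleting `k` or deleting the other index of `z ∖ u` — neither is `p₀`. -/
theorem twoFace_of_defectOne (hD : DefectOneSchanuel) : TwoFaceSchanuel := by
  intro n
  induction n with
  | zero =>
    intro z hz p₀
    have hne : ∀ i, z i ≠ 0 := fun i => hz.ne_zero i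
    obtain ⟨p, hp⟩ : ∃ p : Fin 2, p ≠ p₀ := by
      fin_cases p₀
      · exact ⟨1, by decide⟩
      · exact ⟨0, by decide⟩
    exact ⟨p, hp, by simpa using one_le_trdeg_of_ne_zero (z ∘ p.succAbove) 0 (hne _)⟩
  | succ n ih =>
    intro z hz p₀
    have hkp : p₀ ≠ p₀.succAbove 0 := (Fin.succAbove_ne p₀ 0).symm
    obtain ⟨j₀, hj₀⟩ := Fin.exists_succAbove_eq hkp
    have hw : LinearIndependent ℚ (z ∘ (p₀.succAbove 0).succAbove) := face_linearIndependent hz _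
    obtain ⟨q, hqj, hq⟩ := ih _ hw j₀
    obtain ⟨t, ht, -⟩ := trdeg_eq_nat z
    have hDz := hD _ z hz
    rw [ht] at hDz
    have hnt : n + 1 + 2 ≤ t + 1 := by exact_mod_cast hDz
    have hz' : ((n + 1 + 1 : ℕ) : Cardinal) ≤
        Algebra.trdeg ℚ ↥(adjoin ℚ (Set.range z ∪ Set.range (cexp ∘ z))) := by
      rw [ht]
      exact_mod_cast (show n + 2 ≤ t by omega)
    rcases face_exchange z (p₀.succAbove 0) q hq hz' with h | h
    · exact ⟨p₀.succAbove 0, hkp.symm, h⟩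
    · refine ⟨(p₀.succAbove 0).succAbove q, fun heq => hqj ?_, h⟩
      exact Fin.succAbove_right_injective (heq.trans hj₀.symm)

/-- piece:proved · `𝓗₂ ⟹ S⁻` (monotonicity; lengths `0, 1` are free). -/
theorem defectOne_of_twoFace (h : TwoFaceSchanuel) : DefectOneSchanuel := by
  intro n z hz
  cases n with
  | zero => simp
  | succ n =>
    cases n with
    | zero => simp
    | succ k =>
      obtain ⟨p, -, hp⟩ := h k z hz 0
      have hle := hp.trans (trdeg_face_le z p)
      calc ((k + 1 + 1 : ℕ) : Cardinal) = ((k + 1 : ℕ) : Cardinal) + 1 := by push_cast; ring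
        _ ≤ _ := add_le_add hle le_rfl

/-- piece:proved · **THEOREM (TWO-FACE HYPERPLANE SCHANUEL).** `S⁻` (stmt-25020) `↔ 𝓗₂`: one-defect Schanuel says
EXACTLY that every coordinate of every ℚ-free tuple (length ≥ 2) lies on a coordinate hyperplane face
satisfying full Schanuel (so such a tuple has at least two Schanuel hyperplane faces). -/
theorem defectOne_iff_twoFace : DefectOneSchanuel ↔ TwoFaceSchanuel :=
  ⟨twoFace_of_defectOne, defectOne_of_twoFace⟩

/-- `𝓗₂ ⟹ 𝓗`. -/
theorem hyperplaneSchanuel_of_twoFace (h : TwoFaceSchanuel) : HyperplaneSchanuel :=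
  hyperplaneSchanuel_of_defectOne (defectOne_of_twoFace h)

end Summit.Schanuel.Schanuel.Theorems.RootDecomp1EHyperplane
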